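/-
Copyright (c) 2026. All rights reserved.
Released under Apache 2.0 license as described in the file LICENSE.
Authors: abc-iut cell — seat abc-iut-w4-d104 (gen 3): the pull-back of a local linear holomorphic structure
(transport along a chart), for the chart model of [AbsTopIII] Cor 2.9 (b) (L4-lead RULING #6j).
-/
import Literature.AnabelianGeometry.AbsoluteAnabelian.HolomorphicCores
import HarnessLib

/-!
# Pull-back of a local linear holomorphic structure along a map ([AbsTopIII] Prop 2.6 / Cor 2.7 (e))

S. Mochizuki, *Topics in absolute anabelian geometry III* (bib key `MochizukiAbsTopIII2015`), Prop 2.6 (b)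
and Cor 2.7 (e), kurims pp.57–60: a "local linear holomorphic structure" on a space is the system of groups
`𝒜_p` with their topological field structures `𝒜_p ∪ {0}` ("`ℂ^×` at `p`") and compatible isomorphisms
`𝒜_p ⥲ 𝒜_{p'}`; Cor 2.9 (a) (p.64 l.45–46) uses the structure on `X^top` DETERMINED BY (transported from)
the one on `E^top`.  abc-iut-L4-t14 typed the notion as the interface `LocalLinearHolStructure`
(`HolomorphicCores.lean`).  This small DEFINITION file records the transport: the **pull-back**
`L.comap f` of a local linear holomorphic structure `L` on `Y` along any map `f : X → Y`
(`𝒜_p := 𝒜_{f p}`, all isomorphisms pulled back), with its `rfl` unfolding lemmas.  It is the structure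
carried by a planar Aut-holomorphic disc `V` read through a chart `e : V → 𝔻` (pull-back of the plane
structure of `ArchimedeanReconstructionCor29ModelProofs`), used by the chart model of Cor 2.9 (b).  No
instance, no notation; refereed pre-IUT material; nothing here bears on the disputed [IUTchIII] Cor. 3.12.
-/

namespace Literature.AnabelianGeometry.AbsoluteAnabelian

universe u

namespace LocalLinearHolStructure

variable {X Y : Type u}

/-- **Pull-back of a local linear holomorphic structure** along `f : X → Y`: the germ group at `p` is the
germ group of `L` at `f p`, with the same "`ℂ^×` at `p`" isomorphism and the pulled-back transition
isomorphisms (Cor 2.9 (a): the structure on `X^top` determined by that of `E^top` through the local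
homeomorphisms of the elliptic cuspidalization; Cor 2.7 (e) functoriality).
[cite: MochizukiAbsTopIII2015, Corollary 2.7 (e) p.60] -/
noncomputable def comap (L : LocalLinearHolStructure Y) (f : X → Y) : LocalLinearHolStructure X where
  A p := L.A (f p)
  isoUnits p := L.isoUnits (f p)
  trans p p' := L.trans (f p) (f p')
  trans_self p := L.trans_self (f p)
  trans_comp p p' p'' := L.trans_comp (f p) (f p') (f p'')
  trans_isoUnits p p' := L.trans_isoUnits (f p) (f p')

/-- The germ groups of the pull-back are those of `L` at the image points.
[cite: MochizukiAbsTopIII2015, Corollary 2.7 (e) p.60] -/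
theorem comap_A (L : LocalLinearHolStructure Y) (f : X → Y) (p : X) : (L.comap f).A p = L.A (f p) := rfl

/-- The "`ℂ^×` at `p`" isomorphism of the pull-back. [cite: MochizukiAbsTopIII2015, Corollary 2.7 (e) p.60] -/
theorem comap_isoUnits (L : LocalLinearHolStructure Y) (f : X → Y) (p : X) :
    (L.comap f).isoUnits p = L.isoUnits (f p) := rfl

/-- The transition isomorphisms of the pull-back. [cite: MochizukiAbsTopIII2015, Corollary 2.7 (e) p.60] -/
theorem comap_trans (L : LocalLinearHolStructure Y) (f : X → Y) (p p' : X) :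
    (L.comap f).trans p p' = L.trans (f p) (f p') := rfl

/-- Pulling back along the identity changes nothing. [cite: MochizukiAbsTopIII2015, Corollary 2.7 (e) p.60] -/
theorem comap_id (L : LocalLinearHolStructure Y) : L.comap id = L := rfl

end LocalLinearHolStructure

end Literature.AnabelianGeometry.AbsoluteAnabelian
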